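import Mathlib
import Summits.ValiantsHypothesis.ValiantsHypothesis.Theorems.BinomialElusiveBinomialMapsElusiveDeepToric

/-!
# Crux `BinomialElusive.BinomialMapsElusive` (stmt-ValiantsHypothesis-7393) — honest AND cancelling
# coordinates: one collision of exact orders is forced

Local setting as in `BinomialElusiveBinomialMapsElusiveDeepToric` / `…HonestCollision`: series
`p_j` (`j ∈ σ`) in a Hahn-series field of characteristic `0`, binomial identities
`U_i + V_i = T_i := t^{e_i} + t^{e_i+g_i}` (`U_i = α_i p^{A_i}`, `V_i = β_i p^{B_i}`, `g_i > 0`).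
By the valuation trichotomy every coordinate is (after renaming `A_i ↔ B_i`) exactly one of
* HONEST: `V_i = 0` or `ord V_i > e_i` — exact order `ε_i = ord(t^{g_i} - t^{-e_i} V_i)` of the
  integer vector `A_i` (`= min(g_i, depth)` off resonance);
* CANCELLING: `ord V_i < e_i` (then `ord U_i = ord V_i` and the leading coefficients cancel) — exact
  order `ε_i = ord(T_i / V_i) = e_i - ord V_i` (the cancellation depth) of the vector `A_i - B_i`;
* TIED: `ord V_i = e_i` (both monomials of order exactly `e_i`) — not treated here.

**Theorem `card_le_of_noTie_orderTop_injective`.**  If no coordinate is tied, no honest coordinate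
is a pure monomial substitution (`V_i ≠ t^{e_i+g_i}`), and the exact orders `ε_i` are pairwise
distinct, then `#coordinates ≤ #variables`.  So every tie-free local binomial swallower from fewer
variables than coordinates has a monomial-substitution coordinate or a COLLISION `ε_i = ε_j`
(`i ≠ j`): two equal depths, a depth equal to a gap, a cancellation depth equal to a depth or a gap,
… (structure note `Cruxes/BinomialMapsElusive/STRUCTURE-p1.md`, (F1)–(F2)).  Crux-vocabulary
wrapper: `le_of_noTie_aeval`.  Tools: the exact-order lemma
(`card_le_of_orderTop_monomial_injective`) and the helpers of the deep-toric file.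
-/

-- layout Summits/ValiantsHypothesis/ValiantsHypothesis forces the duplicated namespace component
set_option linter.dupNamespace false

namespace Summit.ValiantsHypothesis.ValiantsHypothesis.Theorems.BinomialMapsElusiveCollision

open scoped BigOperators
open Finset
open Summit.ValiantsHypothesis.ValiantsHypothesis.Theorems.BinomialMapsElusiveExactOrders
open Summit.ValiantsHypothesis.ValiantsHypothesis.Theorems.BinomialMapsElusiveDeepToric

variable {Δ : Type*} [AddCommGroup Δ] [LinearOrder Δ] [IsOrderedAddMonoid Δ]
  {R : Type*} [Field R]

/-! ### The common decomposition `p_j = single ν_j c_j · w_j` and monomials in it -/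

/-- A nonzero monomial `α • p^A` in series `p_j = single ν_j c_j · w_j` is
`single ⟨A,ν⟩ (α c^A) · w^A`. -/
theorem smul_prod_pow_eq {σ : Type*} [Fintype σ] (p w : σ → HahnSeries Δ R) (ν : σ → Δ) (c : σ → R)
    (hpw : ∀ j, p j ≠ 0 → p j = HahnSeries.single (ν j) (c j) * w j)
    (A : σ → ℕ) (α : R) (hne : α • ∏ j, p j ^ A j ≠ 0) :
    α • ∏ j, p j ^ A j = HahnSeries.single (∑ j, A j • ν j) (α * ∏ j, c j ^ A j) * ∏ j, w j ^ A j := by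
  classical
  have hp : ∀ j, A j ≠ 0 → p j ≠ 0 := fun j hA hpj => by
    apply hne
    rw [Finset.prod_eq_zero (Finset.mem_univ j) (by rw [hpj, zero_pow hA]), smul_zero]
  have h1 : ∀ j, p j ^ A j = HahnSeries.single (A j • ν j) (c j ^ A j) * w j ^ A j := by
    intro j
    by_cases hA : A j = 0
    · simp [hA]
    · rw [hpw j (hp j hA), mul_pow, HahnSeries.single_pow]
  simp_rw [h1]
  have h2 : ∀ s : Finset σ, ∏ j ∈ s, HahnSeries.single (A j • ν j) (c j ^ A j) =
      HahnSeries.single (∑ j ∈ s, A j • ν j) (∏ j ∈ s, c j ^ A j) := by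
    intro s
    induction s using Finset.induction_on with
    | empty => simp
    | insert a s ha ih => rw [Finset.prod_insert ha, Finset.sum_insert ha, Finset.prod_insert ha, ih,
        HahnSeries.single_mul_single]
  rw [Finset.prod_mul_distrib, h2, ← HahnSeries.C_mul_eq_smul, ← mul_assoc, HahnSeries.C_apply,
    HahnSeries.single_mul_single, zero_add]

/-- The coefficient `α c^A` of a nonzero monomial is nonzero. -/
theorem coeff_ne_zero_of_smul_prod_pow_ne_zero {σ : Type*} [Fintype σ] (p : σ → HahnSeries Δ R)
    (c : σ → R) (hc : ∀ j, c j ≠ 0) (A : σ → ℕ) (α : R) (hne : α • ∏ j, p j ^ A j ≠ 0) :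
    α * ∏ j, c j ^ A j ≠ 0 := by
  refine mul_ne_zero ?_ (Finset.prod_ne_zero_iff.mpr fun j _ => pow_ne_zero _ (hc j))
  rintro rfl; exact hne (by simp)

variable [CharZero R]

/-- In a Hahn-series field, the order of the inverse is the negative of the order. -/
theorem orderTop_inv {x : HahnSeries Δ R} (hx : x ≠ 0) {f : Δ} (hf : x.orderTop = f) :
    x⁻¹.orderTop = ((-f : Δ) : WithTop Δ) := by
  have hx' : x⁻¹ ≠ 0 := inv_ne_zero hx
  obtain ⟨v, hv⟩ := WithTop.ne_top_iff_exists.mp (HahnSeries.orderTop_ne_top.mpr hx')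
  have h := HahnSeries.orderTop_mul x x⁻¹
  rw [mul_inv_cancel₀ hx, ← HahnSeries.single_zero_one, HahnSeries.orderTop_single one_ne_zero,
    hf, ← hv, ← WithTop.coe_add, WithTop.coe_eq_coe] at h
  rw [← hv, WithTop.coe_eq_coe]
  have : v = -f := by rw [eq_neg_iff_add_eq_zero, add_comm]; exact h.symm
  exact this

/-! ### The two coordinate types -/

omit [CharZero R] in
/-- **Honest coordinate.**  If `U + V = t^e + t^{e+g}` with `U = α p^A`, `V = 0` or `ord V > e`,
then `w^A = 1 + (t^g - t^{-e} V)`. -/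
theorem honest_monomial_eq {σ : Type*} [Fintype σ] (p w : σ → HahnSeries Δ R) (ν : σ → Δ)
    (c : σ → R) (hpw : ∀ j, p j ≠ 0 → p j = HahnSeries.single (ν j) (c j) * w j)
    (hw : ∀ j, 0 < (w j - 1).orderTop) (hc : ∀ j, c j ≠ 0)
    (A : σ → ℕ) (α : R) (V : HahnSeries Δ R) (e g : Δ) (hg : 0 < g)
    (hsol : α • ∏ j, p j ^ A j + V = HahnSeries.single e 1 + HahnSeries.single (e + g) 1)
    (hV : V = 0 ∨ ((e : Δ) : WithTop Δ) < V.orderTop) :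
    ∏ j, w j ^ (A j : ℤ) = 1 + (HahnSeries.single g (1 : R) - HahnSeries.single (-e) 1 * V) := by
  classical
  set T : HahnSeries Δ R := HahnSeries.single e 1 + HahnSeries.single (e + g) 1 with hT
  set U : HahnSeries Δ R := α • ∏ j, p j ^ A j with hU
  have hT_ord : T.orderTop = e := orderTop_target hg
  have hV_ord : ((e : Δ) : WithTop Δ) < V.orderTop := by
    rcases hV with h | h
    · rw [h, HahnSeries.orderTop_zero]; exact WithTop.coe_lt_top _
    · exact h
  have hUeq : U = T + -V := by rw [← sub_eq_add_neg, eq_sub_iff_add_eq]; exact hsol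
  have hU_ord : U.orderTop = e := by
    rw [hUeq, HahnSeries.orderTop_add_eq_left (by rw [hT_ord, HahnSeries.orderTop_neg]; exact hV_ord),
      hT_ord]
  have hU_ne : U ≠ 0 := fun h => by
    rw [h, HahnSeries.orderTop_zero] at hU_ord; exact WithTop.top_ne_coe hU_ord
  have hU_coeff : U.coeff e = 1 := by
    rw [hUeq, HahnSeries.coeff_add, HahnSeries.coeff_neg, HahnSeries.coeff_eq_zero_of_lt_orderTop hV_ord,
      neg_zero, add_zero, hT, HahnSeries.coeff_add, HahnSeries.coeff_single_same,
      HahnSeries.coeff_single_of_ne, add_zero]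
    exact ne_of_lt (lt_add_of_pos_right _ hg)
  -- decompose `U`
  set W : HahnSeries Δ R := ∏ j, w j ^ A j with hW
  set κ : R := α * ∏ j, c j ^ A j with hκ
  set E : Δ := ∑ j, A j • ν j with hE
  have hUW : U = HahnSeries.single E κ * W := smul_prod_pow_eq p w ν c hpw A α hU_ne
  have hκ_ne : κ ≠ 0 := coeff_ne_zero_of_smul_prod_pow_ne_zero p c hc A α hU_ne
  have hW_pr : 0 < (W - 1).orderTop :=
    (lt_orderTop_prod_sub_one Finset.univ (fun j => w j ^ A j) (fun j _ => principal_pow (hw j) _)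
      WithTop.zero_ne_top (fun j _ => principal_pow (hw j) _)).1
  have hE_eq : E = e := by
    have h := hU_ord
    rw [hUW, HahnSeries.orderTop_mul, HahnSeries.orderTop_single hκ_ne,
      orderTop_eq_zero_of_principal hW_pr, add_zero] at h
    exact WithTop.coe_injective h
  have hκ_eq : κ = 1 := by
    have h := hU_coeff
    rw [hUW, ← hE_eq, HahnSeries.coeff_single_mul, sub_self] at h
    have hW0 : W.coeff 0 = 1 := by
      have h0 : (W - 1).coeff 0 = 0 := HahnSeries.coeff_eq_zero_of_lt_orderTop hW_pr
      rw [HahnSeries.coeff_sub, HahnSeries.coeff_one, if_pos rfl, sub_eq_zero] at h0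
      exact h0
    rw [hW0, mul_one] at h
    exact h
  have h1 : W = HahnSeries.single (-e) (1 : R) * U := by
    rw [hUW, hκ_eq, hE_eq, ← mul_assoc, HahnSeries.single_mul_single, neg_add_cancel, mul_one,
      HahnSeries.single_zero_one, one_mul]
  simp only [zpow_natCast]
  rw [show (∏ j, w j ^ A j) = W from rfl, h1, hUeq, hT]
  simp only [mul_add, mul_neg, HahnSeries.single_mul_single, one_mul, neg_add_cancel,
    neg_add_cancel_left, HahnSeries.single_zero_one]
  ring

/-- **Cancelling coordinate.**  If `U + V = T := t^e + t^{e+g}` with `U = α p^A`, `V = β p^B` and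
`ord V < e`, then `w^{A - B} = 1 - T/V` (the leading coefficients of `U` and `V` cancel). -/
theorem cancel_monomial_eq {σ : Type*} [Fintype σ] (p w : σ → HahnSeries Δ R) (ν : σ → Δ)
    (c : σ → R) (hpw : ∀ j, p j ≠ 0 → p j = HahnSeries.single (ν j) (c j) * w j)
    (hw : ∀ j, 0 < (w j - 1).orderTop) (hc : ∀ j, c j ≠ 0)
    (A B : σ → ℕ) (α β : R) (e g : Δ) (hg : 0 < g)
    (hsol : α • ∏ j, p j ^ A j + β • ∏ j, p j ^ B j =
      HahnSeries.single e 1 + HahnSeries.single (e + g) 1)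
    (hV : (β • ∏ j, p j ^ B j).orderTop < ((e : Δ) : WithTop Δ)) :
    ∏ j, w j ^ ((A j : ℤ) - B j) =
      1 - (HahnSeries.single e 1 + HahnSeries.single (e + g) 1) * (β • ∏ j, p j ^ B j)⁻¹ := by
  classical
  set T : HahnSeries Δ R := HahnSeries.single e 1 + HahnSeries.single (e + g) 1 with hT
  set U : HahnSeries Δ R := α • ∏ j, p j ^ A j with hU
  set V : HahnSeries Δ R := β • ∏ j, p j ^ B j with hV'
  have hT_ord : T.orderTop = e := orderTop_target hg
  have hT_ne : T ≠ 0 := fun h => by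
    rw [h, HahnSeries.orderTop_zero] at hT_ord; exact WithTop.top_ne_coe hT_ord
  have hV_ne : V ≠ 0 := fun h => by
    rw [h, HahnSeries.orderTop_zero] at hV
    exact not_top_lt hV
  obtain ⟨f, hf⟩ := WithTop.ne_top_iff_exists.mp (HahnSeries.orderTop_ne_top.mpr hV_ne)
  have hf' : V.orderTop = f := hf.symm
  have hUeq : U = T + -V := by rw [← sub_eq_add_neg, eq_sub_iff_add_eq]; exact hsol
  have hU_ord : U.orderTop = f := by
    rw [hUeq, HahnSeries.orderTop_add_eq_right (by rw [HahnSeries.orderTop_neg, hT_ord]; exact hV),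
      HahnSeries.orderTop_neg, hf']
  have hU_ne : U ≠ 0 := fun h => by
    rw [h, HahnSeries.orderTop_zero] at hU_ord; exact WithTop.top_ne_coe hU_ord
  -- decompose `U` and `V`
  set WA : HahnSeries Δ R := ∏ j, w j ^ A j with hWA
  set WB : HahnSeries Δ R := ∏ j, w j ^ B j with hWB
  set κ : R := α * ∏ j, c j ^ A j with hκ
  set κ' : R := β * ∏ j, c j ^ B j with hκ'
  set EA : Δ := ∑ j, A j • ν j with hEA
  set EB : Δ := ∑ j, B j • ν j with hEB
  have hUW : U = HahnSeries.single EA κ * WA := smul_prod_pow_eq p w ν c hpw A α hU_ne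
  have hVW : V = HahnSeries.single EB κ' * WB := smul_prod_pow_eq p w ν c hpw B β hV_ne
  have hκ_ne : κ ≠ 0 := coeff_ne_zero_of_smul_prod_pow_ne_zero p c hc A α hU_ne
  have hκ'_ne : κ' ≠ 0 := coeff_ne_zero_of_smul_prod_pow_ne_zero p c hc B β hV_ne
  have hWA_pr : 0 < (WA - 1).orderTop :=
    (lt_orderTop_prod_sub_one Finset.univ (fun j => w j ^ A j) (fun j _ => principal_pow (hw j) _)
      WithTop.zero_ne_top (fun j _ => principal_pow (hw j) _)).1
  have hWB_pr : 0 < (WB - 1).orderTop :=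
    (lt_orderTop_prod_sub_one Finset.univ (fun j => w j ^ B j) (fun j _ => principal_pow (hw j) _)
      WithTop.zero_ne_top (fun j _ => principal_pow (hw j) _)).1
  have hEA_eq : EA = f := by
    have h := hU_ord
    rw [hUW, HahnSeries.orderTop_mul, HahnSeries.orderTop_single hκ_ne,
      orderTop_eq_zero_of_principal hWA_pr, add_zero] at h
    exact WithTop.coe_injective h
  have hEB_eq : EB = f := by
    have h := hf'
    rw [hVW, HahnSeries.orderTop_mul, HahnSeries.orderTop_single hκ'_ne,
      orderTop_eq_zero_of_principal hWB_pr, add_zero] at h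
    exact WithTop.coe_injective h
  have hWB_ne : WB ≠ 0 := ne_zero_of_principal hWB_pr
  have hw_ne : ∀ j, w j ≠ 0 := fun j => ne_zero_of_principal (hw j)
  -- the quotient monomial `Q = WA / WB = w^{A-B}`
  have hQ : ∏ j, w j ^ ((A j : ℤ) - B j) = WA * WB⁻¹ := by
    simp only [hWA, hWB]
    rw [← Finset.prod_inv_distrib, ← Finset.prod_mul_distrib]
    refine Finset.prod_congr rfl fun j _ => ?_
    rw [zpow_sub₀ (hw_ne j), zpow_natCast, zpow_natCast, div_eq_mul_inv]
  have hQ_pr : 0 < (WA * WB⁻¹ - 1).orderTop := by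
    have hinv : 0 < (WB⁻¹ - 1).orderTop := by rw [orderTop_inv_sub_one hWB_pr]; exact hWB_pr
    exact principal_mul hWA_pr hinv
  -- `Q = r · (T/V - 1)` with `r = κ / κ'`... computed from `U = T - V`
  have hsf : HahnSeries.single f κ ≠ (0 : HahnSeries Δ R) := HahnSeries.single_ne_zero hκ_ne
  have hsf' : HahnSeries.single f κ' ≠ (0 : HahnSeries Δ R) := HahnSeries.single_ne_zero hκ'_ne
  have hWA' : WA = (HahnSeries.single f κ)⁻¹ * U := by
    rw [hUW, hEA_eq, ← mul_assoc, inv_mul_cancel₀ hsf, one_mul]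
  have hWB' : WB⁻¹ = (HahnSeries.single f κ') * V⁻¹ := by
    rw [hVW, hEB_eq, mul_inv, ← mul_assoc, mul_inv_cancel₀ hsf', one_mul]
  set r : R := κ⁻¹ * κ' with hr
  have hQeq : WA * WB⁻¹ = HahnSeries.C r * (T * V⁻¹ - 1) := by
    rw [hWA', hWB', hUeq, HahnSeries.inv_single, HahnSeries.C_apply]
    have hVinv : V * V⁻¹ = 1 := mul_inv_cancel₀ hV_ne
    calc HahnSeries.single (-f) κ⁻¹ * (T + -V) * (HahnSeries.single f κ' * V⁻¹)
        = (HahnSeries.single (-f) κ⁻¹ * HahnSeries.single f κ') * ((T + -V) * V⁻¹) := by ring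
      _ = HahnSeries.single 0 r * (T * V⁻¹ - 1) := by
          rw [HahnSeries.single_mul_single, neg_add_cancel, hr, add_mul, neg_mul, hVinv, sub_eq_add_neg]
  -- the constant term forces `r = -1`
  have hTV_ord : (0 : WithTop Δ) < (T * V⁻¹).orderTop := by
    rw [HahnSeries.orderTop_mul, hT_ord, orderTop_inv hV_ne hf', ← WithTop.coe_add, ← WithTop.coe_zero,
      WithTop.coe_lt_coe]
    have : ((f : Δ) : WithTop Δ) < e := by rw [← hf']; exact hV
    have := WithTop.coe_lt_coe.mp this
    exact lt_add_neg_iff_add_lt.mpr (by simpa using this)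
  have hr1 : r = -1 := by
    have h0 : (WA * WB⁻¹ - 1).coeff 0 = 0 := HahnSeries.coeff_eq_zero_of_lt_orderTop hQ_pr
    rw [hQeq, HahnSeries.coeff_sub, HahnSeries.C_mul_eq_smul, HahnSeries.coeff_smul,
      HahnSeries.coeff_sub, HahnSeries.coeff_eq_zero_of_lt_orderTop hTV_ord, HahnSeries.coeff_one,
      if_pos rfl] at h0
    simp only [smul_eq_mul] at h0
    linear_combination -h0
  rw [hQ, hQeq, hr1]
  simp [sub_eq_add_neg, add_comm]

/-! ### The collision theorem -/

/-- **Tie-free local binomial swallowers have colliding exact orders.**  See the module doc-string: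
`U_i + V_i = t^{e_i} + t^{e_i+g_i}`, `g_i > 0`, every coordinate honest (`V_i = 0 ∨ ord V_i > e_i`)
or cancelling (`ord V_i < e_i`), no honest coordinate a monomial substitution, exact orders pairwise
distinct ⟹ `|ι| ≤ |σ|`. -/
theorem card_le_of_noTie_orderTop_injective {σ ι : Type*} [Fintype σ] [Fintype ι]
    (p : σ → HahnSeries Δ R) (A B : ι → σ → ℕ) (α β : ι → R) (e g : ι → Δ)
    (hg0 : ∀ i, 0 < g i)
    (hsol : ∀ i, α i • ∏ j, p j ^ A i j + β i • ∏ j, p j ^ B i j =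
      HahnSeries.single (e i) 1 + HahnSeries.single (e i + g i) 1)
    (hnoTie : ∀ i, (β i • ∏ j, p j ^ B i j = 0 ∨
      ((e i : Δ) : WithTop Δ) < (β i • ∏ j, p j ^ B i j).orderTop) ∨
      (β i • ∏ j, p j ^ B i j).orderTop < ((e i : Δ) : WithTop Δ))
    (hmono : ∀ i, β i • ∏ j, p j ^ B i j ≠ HahnSeries.single (e i + g i) 1)
    (hinj : Function.Injective fun i =>
      if (β i • ∏ j, p j ^ B i j).orderTop < ((e i : Δ) : WithTop Δ) then
        ((HahnSeries.single (e i) 1 + HahnSeries.single (e i + g i) 1) *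
          (β i • ∏ j, p j ^ B i j)⁻¹).orderTop
      else (HahnSeries.single (g i) (1 : R) -
        HahnSeries.single (-e i) 1 * (β i • ∏ j, p j ^ B i j)).orderTop) :
    Fintype.card ι ≤ Fintype.card σ := by
  classical
  -- the common decomposition of the variables
  set ν : σ → Δ := fun j => (p j).order with hν
  set c : σ → R := fun j => if p j = 0 then 1 else (p j).leadingCoeff with hc
  set w : σ → HahnSeries Δ R := fun j =>
    if p j = 0 then 1 else HahnSeries.single (-(p j).order) (p j).leadingCoeff⁻¹ * p j with hw
  have hw_pr : ∀ j, 0 < (w j - 1).orderTop := fun j => by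
    by_cases hpj : p j = 0
    · simp [hw, hpj]
    · simp only [hw, if_neg hpj]; exact (decompose hpj).2
  have hpw : ∀ j, p j ≠ 0 → p j = HahnSeries.single (ν j) (c j) * w j := fun j hpj => by
    simp only [hν, hc, hw, if_neg hpj]; exact (decompose hpj).1
  have hc_ne : ∀ j, c j ≠ 0 := fun j => by
    by_cases hpj : p j = 0
    · simp [hc, hpj]
    · simp only [hc, if_neg hpj]; exact HahnSeries.leadingCoeff_ne_zero.mpr hpj
  -- the frame vector of each coordinate and its monomial
  set n : ι → σ → ℤ := fun i j =>
    if (β i • ∏ j, p j ^ B i j).orderTop < ((e i : Δ) : WithTop Δ) then (A i j : ℤ) - B i j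
    else (A i j : ℤ) with hn
  have hE : ∀ i, ∏ j, w j ^ n i j - 1 =
      if (β i • ∏ j, p j ^ B i j).orderTop < ((e i : Δ) : WithTop Δ) then
        -((HahnSeries.single (e i) 1 + HahnSeries.single (e i + g i) 1) * (β i • ∏ j, p j ^ B i j)⁻¹)
      else HahnSeries.single (g i) (1 : R) - HahnSeries.single (-e i) 1 * (β i • ∏ j, p j ^ B i j) := by
    intro i
    by_cases hci : (β i • ∏ j, p j ^ B i j).orderTop < ((e i : Δ) : WithTop Δ)
    · simp only [hn, if_pos hci]
      rw [cancel_monomial_eq p w ν c hpw hw_pr hc_ne (A i) (B i) (α i) (β i) (e i) (g i) (hg0 i)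
        (hsol i) hci]
      ring
    · simp only [hn, if_neg hci]
      have hhon : β i • ∏ j, p j ^ B i j = 0 ∨
          ((e i : Δ) : WithTop Δ) < (β i • ∏ j, p j ^ B i j).orderTop := by
        rcases hnoTie i with h | h
        · exact h
        · exact absurd h hci
      rw [honest_monomial_eq p w ν c hpw hw_pr hc_ne (A i) (α i) (β i • ∏ j, p j ^ B i j) (e i) (g i)
        (hg0 i) (hsol i) hhon]
      ring
  refine card_le_of_orderTop_monomial_injective w hw_pr n (fun i h1 => ?_) (fun i i' h => ?_)
  · -- `w^{n_i} ≠ 1`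
    have h0 : ∏ j, w j ^ n i j - 1 = 0 := by rw [h1, sub_self]
    rw [hE i] at h0
    by_cases hci : (β i • ∏ j, p j ^ B i j).orderTop < ((e i : Δ) : WithTop Δ)
    · rw [if_pos hci, neg_eq_zero, mul_eq_zero] at h0
      rcases h0 with h0 | h0
      · have := orderTop_target (R := R) (e := e i) (hg0 i)
        rw [h0, HahnSeries.orderTop_zero] at this
        exact WithTop.top_ne_coe this
      · have hVne : β i • ∏ j, p j ^ B i j ≠ 0 := fun hz => by
          rw [hz, HahnSeries.orderTop_zero] at hci; exact not_top_lt hci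
        exact inv_ne_zero hVne h0
    · rw [if_neg hci, sub_eq_zero] at h0
      apply hmono i
      have h3 := congr_arg (fun y => HahnSeries.single (e i) (1 : R) * y) h0
      simp only [HahnSeries.single_mul_single, ← mul_assoc, add_neg_cancel, mul_one,
        HahnSeries.single_zero_one, one_mul] at h3
      exact h3.symm
  · -- injectivity: the order of `w^{n_i} - 1` is the displayed exact order
    apply hinj
    have key : ∀ i, (∏ j, w j ^ n i j - 1).orderTop =
        (if (β i • ∏ j, p j ^ B i j).orderTop < ((e i : Δ) : WithTop Δ) then
          ((HahnSeries.single (e i) 1 + HahnSeries.single (e i + g i) 1) *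
            (β i • ∏ j, p j ^ B i j)⁻¹).orderTop
        else (HahnSeries.single (g i) (1 : R) -
          HahnSeries.single (-e i) 1 * (β i • ∏ j, p j ^ B i j)).orderTop) := by
      intro i
      rw [hE i]
      by_cases hci : (β i • ∏ j, p j ^ B i j).orderTop < ((e i : Δ) : WithTop Δ)
      · rw [if_pos hci, if_pos hci, HahnSeries.orderTop_neg]
      · rw [if_neg hci, if_neg hci]
    simp only
    rw [← key i, ← key i']
    exact h

/-- **Crux vocabulary** (`MvPolynomial` monomials, `LaurentSeries` targets `t^{N a_i} + t^{N b_i}`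
as produced by `numericToPuiseux_proof`; `V_i := Γ`'s second monomial evaluated at `p`): a tie-free
local binomial swallower `Γ_i = α_i y^{A_i} + β_i y^{B_i}` with no monomial-substitution coordinate
and pairwise distinct exact orders (`ord(T_i/V_i)` for cancelling, `ord(t^{N(b_i-a_i)} - t^{-N a_i}V_i)`
for honest coordinates) has `m ≤ s`. -/
theorem le_of_noTie_aeval {s m : ℕ} (Γ : Fin m → MvPolynomial (Fin s) R)
    (A B : Fin m → Fin s →₀ ℕ) (α β : Fin m → R)
    (hΓ : ∀ i, Γ i = MvPolynomial.monomial (A i) (α i) + MvPolynomial.monomial (B i) (β i))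
    (N : ℕ) (hN : 0 < N) (a b : Fin m → ℕ) (hab : ∀ i, a i < b i) (p : Fin s → LaurentSeries R)
    (hsol : ∀ i, MvPolynomial.aeval p (Γ i) =
      HahnSeries.single ((N * a i : ℕ) : ℤ) 1 + HahnSeries.single ((N * b i : ℕ) : ℤ) 1)
    (hnoTie : ∀ i, (MvPolynomial.aeval p (MvPolynomial.monomial (B i) (β i)) = 0 ∨
      (((N * a i : ℕ) : ℤ) : WithTop ℤ) <
        (MvPolynomial.aeval p (MvPolynomial.monomial (B i) (β i))).orderTop) ∨
      (MvPolynomial.aeval p (MvPolynomial.monomial (B i) (β i))).orderTop <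
        (((N * a i : ℕ) : ℤ) : WithTop ℤ))
    (hmono : ∀ i, MvPolynomial.aeval p (MvPolynomial.monomial (B i) (β i)) ≠
      HahnSeries.single ((N * b i : ℕ) : ℤ) 1)
    (hinj : Function.Injective fun i =>
      if (MvPolynomial.aeval p (MvPolynomial.monomial (B i) (β i))).orderTop <
          (((N * a i : ℕ) : ℤ) : WithTop ℤ) then
        ((HahnSeries.single ((N * a i : ℕ) : ℤ) (1 : R) + HahnSeries.single ((N * b i : ℕ) : ℤ) 1) *
          (MvPolynomial.aeval p (MvPolynomial.monomial (B i) (β i)))⁻¹).orderTop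
      else (HahnSeries.single (((N * b i : ℕ) : ℤ) - ((N * a i : ℕ) : ℤ)) (1 : R) -
        HahnSeries.single (-((N * a i : ℕ) : ℤ)) 1 *
          MvPolynomial.aeval p (MvPolynomial.monomial (B i) (β i))).orderTop) :
    m ≤ s := by
  have hg0 : ∀ i, (0 : ℤ) < ((N * b i : ℕ) : ℤ) - ((N * a i : ℕ) : ℤ) := fun i => by
    have : N * a i < N * b i := Nat.mul_lt_mul_of_pos_left (hab i) hN
    omega
  have heg : ∀ i, ((N * a i : ℕ) : ℤ) + (((N * b i : ℕ) : ℤ) - ((N * a i : ℕ) : ℤ)) = ((N * b i : ℕ) : ℤ) :=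
    fun i => by ring
  have key := card_le_of_noTie_orderTop_injective (σ := Fin s) (ι := Fin m) p
    (fun i j => A i j) (fun i j => B i j) α β (fun i => ((N * a i : ℕ) : ℤ))
    (fun i => ((N * b i : ℕ) : ℤ) - ((N * a i : ℕ) : ℤ)) hg0
    (fun i => by
      rw [← aeval_monomial_eq_smul_prod, ← aeval_monomial_eq_smul_prod, ← map_add, ← hΓ, hsol i, heg])
    (fun i => by rw [← aeval_monomial_eq_smul_prod]; exact hnoTie i)
    (fun i => by rw [← aeval_monomial_eq_smul_prod, heg]; exact hmono i)
    (fun i i' h => by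
      apply hinj
      simp only [← aeval_monomial_eq_smul_prod, heg] at h ⊢
      exact h)
  simpa using key

end Summit.ValiantsHypothesis.ValiantsHypothesis.Theorems.BinomialMapsElusiveCollision
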